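import Mathlib
import HarnessLib
import Summits.NavierStokesRegularity.NavierStokesRegularity.Theorems.CompletionRelayChainPhaseISoundStep

/-!
# Route `CompletionRelayChain` — crux `RelayFrontStep` (stmt-NavierStokesRegularity-24850), K-side of `stub_phaseI`,
  work package K5-g: `nodeInv_step` — ONE CHECKER STEP PROPAGATES THE NODE INVARIANT

MODEL-lattice bookkeeping (rung TL-M3-R64); nothing here is a statement about the Navier–Stokes equations.
-/

noncomputable section

set_option linter.dupNamespace false

namespace Summit.NavierStokesRegularity.NavierStokesRegularity.Cruxes.RelayFrontStep.PhaseI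

open Set Checker MeasureTheory
open Literature.Analysis.FluidPDE.TaoCascade
open Summit.NavierStokesRegularity.NavierStokesRegularity.Theorems.TaylorModelReadout (taylorJet taylorJet_zero
  taylorJet_succ_apply)

variable {α : Fin 4 → Fin 4 → Fin 4 → ℤ × ℤ × ℤ → ℝ} {τ : ℝ} {S₀ F₀ B₀ : Fin 4 → ℤ → ℝ} {S F : Fin 4 → ℤ → ℝ → ℝ}

/-- `sMag[c]` is the magnitude of the box component. [this file] -/
theorem sMag_get (st : State) (c : Fin 19) : (sMag st)[c] = ((sBox st)[c]).mag := by
  simp only [sMag, Fin.getElem_fin, Vector.getElem_ofFn]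

/-- `sLag[c]` unfolded. [this file] -/
theorem sLag_get (st : State) (c : Fin 19) :
    (sLag st)[c] = ((agetV (jetLevelsV ivOpsP coefsQ (sBox st) 6) 6 (sBox st))[c]).mag * hPow 6 := by
  simp only [sLag, Fin.getElem_fin, Vector.getElem_ofFn]

/-- `sD[c] = deltaC`. [this file] -/
theorem sD_get (st : State) (c : Fin 19) : (sD st)[c] = deltaC (sBox st) st.emax c := by
  simp only [sD, delta, Fin.getElem_fin, Vector.getElem_ofFn]

-- The step data unfold to huge computations; never let `whnf` unfold them in proofs.
attribute [local irreducible] sBox sMag sD sBv sLag Checker.step Checker.boxGuess Checker.bSearch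

/-- Real box data of the step: lower faces. [this file] -/
def loR (st : State) : Fin 19 → ℝ := fun c => ((((sBox st)[c]).lo : ℚ) : ℝ)
/-- Real box data of the step: upper faces. [this file] -/
def hiR (st : State) : Fin 19 → ℝ := fun c => ((((sBox st)[c]).hi : ℚ) : ℝ)
/-- Real field range on the box: lower. [this file] -/
def FloR (st : State) : Fin 19 → ℝ := fun c => ((((fieldIV (sBox st))[c]).lo : ℚ) : ℝ)
/-- Real field range on the box: upper. [this file] -/
def FhiR (st : State) : Fin 19 → ℝ := fun c => ((((fieldIV (sBox st))[c]).hi : ℚ) : ℝ)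
/-- Real `Δ` of the step. [this file] -/
def DR (st : State) : Fin 19 → ℝ := fun c => (((sD st)[c] : ℚ) : ℝ)
/-- Real bootstrap vector of the step. [this file] -/
def bR (st : State) : Fin 19 → ℝ := fun c => (((sBv st)[c] : ℚ) : ℝ)
/-- Real magnitudes of the box. [this file] -/
def magR (st : State) : Fin 19 → ℝ := fun c => (((sMag st)[c] : ℚ) : ℝ)
/-- Real Lagrange magnitudes of the step. [this file] -/
def JR (st : State) : Fin 19 → ℝ := fun c => ((((agetV (jetLevelsV ivOpsP coefsQ (sBox st) 6) 6 (sBox st))[c]).mag : ℚ) : ℝ)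
/-- The Lipschitz matrix of the step. [this file] -/
def LmR (st : State) : Fin 19 → Fin 19 → ℝ := lipM coefsQ (magR st)

/-- Box membership, real form. [this file] -/
theorem inBoxR_of_Icc {st : State} {y : Fin 19 → ℝ} (hy : y ∈ Icc (loR st) (hiR st)) : InBoxR (sBox st) y :=
  fun c => ⟨hy.1 c, hy.2 c⟩

/-- `Σ_{c'} LmR c c' bR_{c'} = lmB` on the checker's data. [this file] -/
theorem sum_LmR_bR (st : State) (c : Fin 19) : ∑ c', LmR st c c' * bR st c' = ((lmB (sMag st) (sBv st) c : ℚ) : ℝ) := by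
  unfold LmR bR magR
  rw [sum_lipM, lmB_cast]

/-- `lmB ≥ 0` on the checker's data (given the positivity of `Δ` from the bootstrap test). [this file] -/
theorem lmB_sBv_nonneg (st : State) (hD : ∀ c : Fin 19, (0 : ℚ) < (sD st)[c]) (c : Fin 19) :
    0 ≤ lmB (sMag st) (sBv st) c := by
  have hm : ∀ c : Fin 19, (0 : ℚ) ≤ (sMag st)[c] := fun c => by rw [sMag_get]; exact IV.mag_nonneg _
  refine lmB_nonneg hm (fun c => ?_) c
  rw [sBv]
  refine bSearch_nonneg hm (fun c => le_of_lt (hD c)) 6 (fun c => ?_) c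
  simp only [Fin.getElem_fin, Vector.getElem_ofFn]
  have h1 := le_of_lt (hD c)
  have hh : (0 : ℚ) ≤ Checker.h := by norm_num [Checker.h]
  exact mul_nonneg (mul_nonneg (by norm_num) hh) h1

/-- **THE STEP ENCLOSURE**: under the node invariant and the step's tests, the block stays in the a priori box during
the step and ends within `lag + b` of its order-5 Taylor polynomial. [this file] -/
theorem step_enclosure (H : Hyps α τ S₀ F₀ B₀ S F) (h2 : Shell2Bound F₀ S F) {θ : Fin 7 → ℝ} (hθ : TM.InBox θ)
    {m : ℕ} (hmT : ((m : ℝ) + 1) * hR ≤ 147 / 64) {st : State} (hinv : NodeInv S F θ m st)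
    (hok : (step st).ok = true) :
    (∀ t ∈ Icc (0:ℝ) hR, InBoxR (sBox st) (zc S ((m : ℝ) * hR + t))) ∧
    ∀ c : Fin 19, |zc S ((m : ℝ) * hR + hR) c -
        ∑ k ∈ Finset.range 6, taylorJet fieldF (zc S ((m : ℝ) * hR)) k c * hR ^ k| ≤
      (((sLag st)[c] + (sBv st)[c] : ℚ) : ℝ) := by
  obtain ⟨hT, hI1, hI2, hemax, _⟩ := hinv
  obtain ⟨hokBox, hokT', _, _, hokB⟩ := step_ok st hok
  have hboxT := of_decide_eq_true hokBox
  have hbT := of_decide_eq_true hokB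
  have hm0 : (0 : ℝ) ≤ m := Nat.cast_nonneg m
  have ha0 : 0 ≤ (m : ℝ) * hR := mul_nonneg hm0 (by norm_num [hR])
  have hh0 : (0 : ℝ) ≤ hR := by norm_num [hR]
  have haT : (m : ℝ) * hR + hR ≤ 147 / 64 := by linarith
  have hah : (m : ℝ) * hR + hR ≤ τ := haT.trans ((by norm_num : (147:ℝ)/64 ≤ 8).trans H.hτ)
  have hD : ∀ c : Fin 19, (0 : ℚ) < (sD st)[c] := fun c => (hbT c).2
  have hΔ : ∀ c : Fin 19, (0 : ℝ) ≤ DR st c := fun c => by unfold DR; exact_mod_cast (hD c).le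
  -- (1) derivative
  have hder := hasDerivWithinAt_zc H ha0 hah
  -- (2) disturbance
  have hT' : st.I1 + Checker.h * (((sBox st)[cix 5 1]).mag * ((sBox st)[cix 5 1]).mag) ≤ 1 / 10 ^ 11 ∧
      st.I2 + Checker.h * (((sBox st)[cix 5 1]).mag * ((sBox st)[cix 5 2]).mag) ≤ 1 / 10 ^ 13 := by
    rw [sMag_get, sMag_get] at hokT'; exact hokT'
  have hdist : ∀ σ ∈ Icc (0:ℝ) hR, (∀ r ∈ Icc (0:ℝ) σ, zc S ((m : ℝ) * hR + r) ∈ Icc (loR st) (hiR st)) →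
      ∀ c, |zv S τ ((m : ℝ) * hR + σ) c - fieldR (zc S ((m : ℝ) * hR + σ)) (zc S ((m : ℝ) * hR + σ)) c| ≤ DR st c := by
    intro σ hσ hhist c
    have hh : ∀ r ∈ Icc (0:ℝ) σ, InBoxR (sBox st) (zc S ((m : ℝ) * hR + r)) := fun r hr => inBoxR_of_Icc (hhist r hr)
    unfold DR
    rw [sD_get]
    exact dist_le_delta H h2 hmT hI1 hI2 hemax hT' hσ hh c
  -- (3) field range on the box
  have hQ : ∀ y ∈ Icc (loR st) (hiR st), ∀ c, FloR st c ≤ fieldR y y c ∧ fieldR y y c ≤ FhiR st c :=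
    fun y hy c => mem_fieldIV (B := sBox st) (y := y) (inBoxR_of_Icc hy) c
  -- (4) the signed a priori test
  have htest : ∀ c : Fin 19, loR st c < zc S ((m : ℝ) * hR + 0) c + hR * min (FloR st c - DR st c) 0 ∧
      zc S ((m : ℝ) * hR + 0) c + hR * max (FhiR st c + DR st c) 0 < hiR st c := by
    intro c
    obtain ⟨h1, h2'⟩ := hboxT c
    rw [add_zero]
    have hrlo : ((((rangeIV st.T)[c]).lo : ℚ) : ℝ) ≤ zc S ((m : ℝ) * hR) c := by
      have : ((rangeIV st.T)[c]).lo = (st.T[c]).lo2 := by simp only [rangeIV, Fin.getElem_fin, Vector.getElem_ofFn]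
      rw [this]; exact TM.lo2_le _ hθ (hT c)
    have hrhi : zc S ((m : ℝ) * hR) c ≤ ((((rangeIV st.T)[c]).hi : ℚ) : ℝ) := by
      have : ((rangeIV st.T)[c]).hi = (st.T[c]).hi2 := by simp only [rangeIV, Fin.getElem_fin, Vector.getElem_ofFn]
      rw [this]; exact TM.le_hi2 _ hθ (hT c)
    rw [← sD] at h1 h2'
    have c1 := (Rat.cast_lt (K := ℝ)).2 h1
    have c2 := (Rat.cast_lt (K := ℝ)).2 h2'
    push_cast at c1 c2
    rw [cast_h] at c1 c2
    unfold loR hiR FloR FhiR DR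
    rw [mul_min_of_nonneg _ _ hh0, mul_zero, mul_max_of_nonneg _ _ hh0, mul_zero]
    constructor <;> linarith
  -- (5) Lagrange bound, Lipschitz, bootstrap
  have hJ : ∀ y ∈ Icc (loR st) (hiR st), ∀ c, |taylorJet fieldF y (5 + 1) c| ≤ JR st c :=
    fun y hy c => abs_jet6_le (B := sBox st) (y := y) (inBoxR_of_Icc hy) c
  have hLm : ∀ c c', 0 ≤ LmR st c c' :=
    lipM_nonneg coefsQ (fun b => by unfold magR; rw [sMag_get]; exact_mod_cast IV.mag_nonneg _)
  have hLip : ∀ y ∈ Icc (loR st) (hiR st), ∀ y' ∈ Icc (loR st) (hiR st), ∀ c,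
      |fieldR y y c - fieldR y' y' c| ≤ ∑ c', LmR st c c' * |y c' - y' c'| := by
    intro y hy y' hy' c
    have hy1 : ∀ b, |y b| ≤ (((sMag st)[b] : ℚ) : ℝ) := fun b => by
      rw [sMag_get]; exact abs_le_mag_of_inBoxR (inBoxR_of_Icc hy) b
    have hy2 : ∀ b, |y' b| ≤ (((sMag st)[b] : ℚ) : ℝ) := fun b => by
      rw [sMag_get]; exact abs_le_mag_of_inBoxR (inBoxR_of_Icc hy') b
    exact abs_fieldR_sub_le (mag := sMag st) hy1 hy2 c
  have hpos : ∀ c, 0 < ∑ c', LmR st c c' * bR st c' + DR st c := by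
    intro c
    rw [sum_LmR_bR]
    have h1 : (0:ℝ) ≤ ((lmB (sMag st) (sBv st) c : ℚ) : ℝ) := by exact_mod_cast lmB_sBv_nonneg st hD c
    have h2 : (0:ℝ) < DR st c := by unfold DR; exact_mod_cast hD c
    linarith
  have hb : ∀ c, hR * (∑ c', LmR st c c' * bR st c' + DR st c) ≤ bR st c := by
    intro c
    rw [sum_LmR_bR]
    have := (Rat.cast_le (K := ℝ)).2 (hbT c).1
    push_cast at this; rw [cast_h] at this
    unfold DR bR; exact this
  -- the step theorem
  have hstep := abs_pseudo_sub_taylor_le_hist (ι := Fin 19) fieldR (T := taylorJet fieldF)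
    (fun x => taylorJet_zero fieldF x) (fun x k c => taylorJet_succ_apply fieldF x k c) hh0 hder hΔ hdist hQ htest
    (p := 5) hJ hLm hLip hpos hb
  refine ⟨fun t ht => inBoxR_of_Icc (hstep t ht).1, fun c => ?_⟩
  have h1 := (hstep hR ⟨hh0, le_rfl⟩).2 c
  simp only [add_zero] at h1
  rw [sum_LmR_bR] at h1
  have hbq := (Rat.cast_le (K := ℝ)).2 (hbT c).1
  push_cast at hbq; rw [cast_h] at hbq
  rw [sLag_get]
  push_cast
  have hp6 : ((hPow 6 : ℚ) : ℝ) = hR ^ (5 + 1) := by simp [hPow, Checker.h, hR]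
  rw [hp6]
  unfold JR DR at h1
  linarith

/-- **ONE STEP PROPAGATES THE NODE INVARIANT.** [this file] -/
theorem nodeInv_step (H : Hyps α τ S₀ F₀ B₀ S F) (h2 : Shell2Bound F₀ S F) {θ : Fin 7 → ℝ} (hθ : TM.InBox θ)
    {m : ℕ} (hmT : ((m : ℝ) + 1) * hR ≤ 147 / 64) {st : State} (hinv : NodeInv S F θ m st)
    (hok : (step st).ok = true) : NodeInv S F θ (m + 1) (step st).next := by
  obtain ⟨hinbox, htay⟩ := step_enclosure H h2 hθ hmT hinv hok
  obtain ⟨hT, hI1, hI2, hemax, henv⟩ := hinv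
  obtain ⟨_, _, hokEnv, hokRel, _⟩ := step_ok st hok
  set a : ℝ := (m : ℝ) * hR with ha
  have hm0 : (0 : ℝ) ≤ m := Nat.cast_nonneg m
  have ha0 : 0 ≤ a := mul_nonneg hm0 (by norm_num [hR])
  have hh0 : (0 : ℝ) ≤ hR := by norm_num [hR]
  have haT : a + hR ≤ 147 / 64 := by rw [ha]; linarith
  have hah : a + hR ≤ τ := haT.trans ((by norm_num : (147:ℝ)/64 ≤ 8).trans H.hτ)
  have hnext : ((m + 1 : ℕ) : ℝ) * hR = a + hR := by push_cast; rw [ha]; ring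
  refine ⟨?_, ?_, ?_, ?_, ?_⟩
  · -- containment at node m+1
    intro c
    rw [hnext, step_T]
    by_cases hc : c.val = 18
    · have hc18 : c = (18 : Fin 19) := Fin.ext hc
      subst hc18
      rw [if_pos (by decide), zc_last]
      exact TM.contains_const (by simp)
    · rw [if_neg hc]
      refine contains_tmStep hθ (x := fun k => taylorJet fieldF (zc S a) k c) ?_
        (contains_jetTM hθ hT (by norm_num) c) (contains_jetTM hθ hT (by norm_num) c)
        (contains_jetTM hθ hT (by norm_num) c) (contains_jetTM hθ hT (by norm_num) c)
        (contains_jetTM hθ hT (by norm_num) c) (htay c)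
      have := hT c
      rwa [show taylorJet fieldF (zc S a) 0 c = zc S a c from by rw [taylorJet_zero]]
  · -- ∫ u₂²
    rw [hnext, step_I1]
    have hu : ∀ r ∈ Icc (0:ℝ) hR, |S 1 2 (a + r)| ≤ (((sBox st)[cix 5 1]).mag : ℚ) := fun r hr => by
      have h := abs_le_mag_of_inBoxR (hinbox r hr) (cix 5 1); rwa [zc_u2] at h
    have h1 := integral_u2sq_le H ha0 hh0 hah hI1 hu
    push_cast; rw [sMag_get, cast_h]
    nlinarith [h1]
  · -- ∫ |r₂u₂|
    rw [hnext, step_I2]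
    have hu : ∀ r ∈ Icc (0:ℝ) hR, |S 1 2 (a + r)| ≤ (((sBox st)[cix 5 1]).mag : ℚ) := fun r hr => by
      have h := abs_le_mag_of_inBoxR (hinbox r hr) (cix 5 1); rwa [zc_u2] at h
    have hr : ∀ r ∈ Icc (0:ℝ) hR, |S 2 2 (a + r)| ≤ (((sBox st)[cix 5 2]).mag : ℚ) := fun r hr => by
      have h := abs_le_mag_of_inBoxR (hinbox r hr) (cix 5 2); rwa [zc_r2] at h
    have h1 := integral_r2u2_le H ha0 hh0 hah hI2 hu hr
    push_cast; rw [sMag_get, sMag_get, cast_h]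
    linarith [h1]
  · -- running maxima
    intro _ r hr c
    rw [step_emax]
    push_cast
    by_cases hra : r ≤ a ∧ 0 < m
    · exact (hemax hra.2 r ⟨hr.1, hra.1⟩ c).trans (le_max_left _ _)
    · have har : a ≤ r := by
        by_cases hm : 0 < m
        · have hn : ¬ r ≤ a := fun h => hra ⟨h, hm⟩
          exact (not_le.1 hn).le
        · have hm0' : m = 0 := by omega
          have : a = 0 := by rw [ha, hm0']; simp
          rw [this]; exact hr.1
      have hr' : r - a ∈ Icc (0:ℝ) hR := ⟨by linarith, by rw [hnext] at hr; linarith [hr.2]⟩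
      have h1 := abs_le_mag_of_inBoxR (hinbox (r - a) hr') c
      rw [show a + (r - a) = r by ring] at h1
      rw [sMag_get]
      exact h1.trans (le_max_right _ _)
  · -- envelope facts
    intro _ r hr
    by_cases hra : r ≤ a ∧ 0 < m
    · exact henv hra.2 r ⟨hr.1, hra.1⟩
    · have har : a ≤ r := by
        by_cases hm : 0 < m
        · have hn : ¬ r ≤ a := fun h => hra ⟨h, hm⟩
          exact (not_le.1 hn).le
        · have hm0' : m = 0 := by omega
          have : a = 0 := by rw [ha, hm0']; simp
          rw [this]; exact hr.1
      have hrT : r ≤ 147 / 64 := by rw [hnext] at hr; linarith [hr.2]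
      have hr' : r - a ∈ Icc (0:ℝ) hR := ⟨by linarith, by rw [hnext] at hr; linarith [hr.2]⟩
      have hb := hinbox (r - a) hr'
      rw [show a + (r - a) = r by ring] at hb
      exact envAt_of_tests H hokEnv hokRel hr.1 hrT hb

end Summit.NavierStokesRegularity.NavierStokesRegularity.Cruxes.RelayFrontStep.PhaseI

end
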